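import Literature.Geometry.DiscreteGeometry.ContactGraphBoundaryWalk
import Literature.Topology.PlaneTopology.PolygonOrientation
import Literature.Topology.PlaneTopology.JordanLoopSides
import Mathlib.Combinatorics.SimpleGraph.Connectivity.Connected
import Mathlib.Combinatorics.SimpleGraph.Paths
import HarnessLib

/-!
# The boundary walk of a non-splitting configuration is a simple closed polygon

Topic `Literature/Geometry/DiscreteGeometry`, sixth file of the proof of Harborth's upper bound
[Harborth1974, (5)]; sequel to `ContactGraphBoundaryWalk.lean`. Harborth (p. 14): "Eine maximale
Lagerung muss notwendig derart zusammenhängend sein, dass kein Kreis alleine diesen Zusammenhang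
herstellt. Es existiert daher ein einfach geschlossenes Randpolygon mit `a` Eckpunkten." We prove
the second sentence from the first for ARBITRARY configurations: if the configuration does not
split (`¬ Harborth.Splits P`: no two non-touching parts, no cut disc), the traced boundary walk
`Harborth.bdry` visits each of its centres once per period (`bdry_injOn`), hence is a simple
closed polygon (`isSimplePolygon_bdry`, via `isSimplePolygon_of_cycle`: cycles of the contact
graph are simple closed polygons because bonds do not cross).

The proof of `bdry_injOn` is the one place where plane topology enters. If the walk passed
twice through a centre `v`, arriving from `a₁` resp. `a₂` and leaving towards `b₁ = succ a₁ v`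
resp. `b₂`, the two traced corners `K₁, K₂` at `v` would lie in one connected piece `U` of the
complement of the drawing (`exists_preconnected_corners`). Since `v` is not a cut disc, `b₁` is
joined to `a₁` by a path of bonds avoiding `v` (`reachable_of_not_splits`); closing it up through
`v` gives a cycle of the contact graph through the corner `K₁`, a Jordan curve (Hopf/Jordan:
`IsSimplePolygon.isJordanLoop`). Near `v` its complement consists of the corner `K₁` and the
opposite sector, which contains `K₂`; by the local two-sidedness of Jordan curves
(`IsJordanLoop.subset_inside_or_of_nhds`) one lies inside and the other outside — but both lie in
the connected set `U` missing the curve, a contradiction.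
-/

noncomputable section

namespace Literature.Geometry.DiscreteGeometry

namespace Harborth

open Complex Set Finset Metric
open Literature.Topology.PlaneTopology
open scoped Real

variable {P : Finset ℂ}

/-! ## §1 Cycles of the contact graph are simple closed polygons -/

/-- The periodic extension to `ℤ` of a sequence `c 0, …, c (n-1)`. [folklore] -/
def cycExt (c : ℕ → ℂ) (n : ℕ) (m : ℤ) : ℂ := c ((m % (n : ℤ)).toNat)

/-- `cycExt` on a shifted natural index. [folklore] -/
private theorem cycExt_add_nat (c : ℕ → ℂ) {n : ℕ} (hn : 0 < n) (m : ℤ) (k : ℕ) :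
    cycExt c n (m + k) = c (((m % (n : ℤ)).toNat + k) % n) := by
  have hT : (0 : ℤ) < n := by exact_mod_cast hn
  have h0 : 0 ≤ (m + k) % (n : ℤ) := Int.emod_nonneg _ hT.ne'
  have h1 : 0 ≤ m % (n : ℤ) := Int.emod_nonneg _ hT.ne'
  rw [cycExt]
  congr 1
  apply Int.ofNat.inj
  simp only [Int.ofNat_eq_natCast, Int.natCast_mod, Int.natCast_add, Int.toNat_of_nonneg h0,
    Int.toNat_of_nonneg h1]
  rw [Int.add_emod (m % _) (k : ℤ), Int.emod_emod_of_dvd m (dvd_refl _), ← Int.add_emod]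

/-- `cycExt` at a natural number. [folklore] -/
private theorem cycExt_natCast (c : ℕ → ℂ) {n : ℕ} (hn : 0 < n) (k : ℕ) : cycExt c n k = c (k % n) := by
  have := cycExt_add_nat c hn 0 k
  rw [zero_add] at this
  rw [this]; simp

/-- `cycExt` is periodic. [folklore] -/
private theorem cycExt_periodic (c : ℕ → ℂ) (n : ℕ) : Function.Periodic (cycExt c n) n := fun m => by
  simp only [cycExt, Int.add_emod_right]

/-- A periodic sequence only depends on the index modulo the period. [folklore] -/
private theorem apply_eq_apply_emod {z : ℤ → ℂ} {n : ℕ} (hper : Function.Periodic z n) (k : ℤ) :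
    z k = z (k % n) := by
  conv_lhs => rw [← Int.emod_add_mul_ediv k n, mul_comm]
  exact hper.int_mul _ _

/-- **Cycles of the contact graph are simple closed polygons.** A periodic sequence of centres,
`n ≥ 3` distinct ones per period, consecutive ones touching, is a simple closed polygon: bonds
with four distinct ends are disjoint and bonds at a common centre meet only there.
[cite: Harborth1974, p. 14] -/
theorem isSimplePolygon_of_cycle (hP : IsHard P) {z : ℤ → ℂ} {n : ℕ} (h3 : 3 ≤ n)
    (hper : Function.Periodic z n) (hmem : ∀ i, z i ∈ P) (hbond : ∀ i, ‖z (i + 1) - z i‖ = 1)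
    (hinj : ∀ i j : ℤ, 0 ≤ i → i < n → 0 ≤ j → j < n → z i = z j → i = j) :
    IsSimplePolygon z n := by
  have hn0 : (n : ℤ) ≠ 0 := by omega
  have hnpos : (0 : ℤ) < n := by omega
  have hdart : ∀ i, (z i, z (i + 1)) ∈ darts P := fun i => mem_darts.2 ⟨⟨hmem i, hmem _⟩, hbond i⟩
  -- equal values force equal indices modulo `n`
  have hinj' : ∀ i j : ℤ, z i = z j → i % n = j % n := by
    intro i j h
    rw [apply_eq_apply_emod hper i, apply_eq_apply_emod hper j] at h
    exact hinj _ _ (Int.emod_nonneg _ hn0) (Int.emod_lt_of_pos _ hnpos) (Int.emod_nonneg _ hn0)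
      (Int.emod_lt_of_pos _ hnpos) h
  refine IsSimplePolygon.of_Ico h3 hper (fun i _ _ => ?_) (fun i j hi0 hin hj0 hjn hji hji1 hij1 => ?_)
    (fun i _ _ => ?_)
  · intro h
    have := hbond i
    rw [h, sub_self, norm_zero] at this
    exact zero_ne_one this
  · have hii : i % n = i := Int.emod_eq_of_lt hi0 hin
    have hjj : j % n = j := Int.emod_eq_of_lt hj0 hjn
    refine disjoint_segment_of_darts hP (hdart i) (hdart j) (fun h => hji ?_) (fun h => hij1 ?_)
      (fun h => hji1 ?_) (fun h => hji ?_)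
    · have := hinj' _ _ h; rw [hii, hjj] at this; exact this.symm
    · have := hinj' _ _ h; rw [hii] at this; exact this
    · have := hinj' _ _ h; rw [hjj] at this; exact this.symm
    · have hm : Int.ModEq n (i + 1) (j + 1) := hinj' _ _ h
      have h3 : i % n = j % n := Int.ModEq.add_right_cancel' 1 hm
      rw [hii, hjj] at h3
      exact h3.symm
  · rw [segment_symm]
    have hq : z (i - 1) ∈ nbrs P (z i) := by
      have := hdart (i - 1); rw [sub_add_cancel] at this
      exact mem_nbrs_of_mk_mem_darts' this
    have hk : z (i + 1) ∈ nbrs P (z i) := mem_nbrs_of_mk_mem_darts (hdart i)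
    refine segment_inter_segment_subset hq hk fun h => ?_
    -- `i - 1 ≡ i + 1 (mod n)` forces `n ∣ 2`
    have hm : Int.ModEq n (i - 1) (i + 1) := hinj' _ _ h
    have hd : (n : ℤ) ∣ (i + 1) - (i - 1) := (Int.modEq_iff_dvd.1 hm)
    rw [show (i + 1) - (i - 1) = 2 by ring] at hd
    have : (n : ℤ) ≤ 2 := Int.le_of_dvd (by norm_num) hd
    omega

/-! ## §2 Paths avoiding a centre: the contact graph with a centre deleted -/

/-- The contact graph of `P` with the centre `v` deleted. [cite: Harborth1974, p. 14] -/
def delGraph (P : Finset ℂ) (v : ℂ) : SimpleGraph ℂ where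
  Adj a b := a ∈ P ∧ b ∈ P ∧ a ≠ v ∧ b ≠ v ∧ ‖b - a‖ = 1
  symm := ⟨fun a b h => ⟨h.2.1, h.1, h.2.2.2.1, h.2.2.1, by rw [norm_sub_rev]; exact h.2.2.2.2⟩⟩
  loopless := ⟨fun a h => by have := h.2.2.2.2; simp at this⟩

/-- **A non-splitting configuration stays connected after deleting a centre**: any two other
centres are joined by a path of bonds avoiding `v` (else `v` would be a cut disc).
[cite: Harborth1974, p. 14] -/
theorem reachable_of_not_splits (hns : ¬ Splits P) {v a b : ℂ} (hv : v ∈ P) (ha : a ∈ P) (hb : b ∈ P)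
    (hav : a ≠ v) (hbv : b ≠ v) : (delGraph P v).Reachable b a := by
  classical
  by_contra hr
  apply hns
  set A := P.filter fun x => (delGraph P v).Reachable b x with hA
  set B := (P.erase v).filter fun x => ¬ (delGraph P v).Reachable b x with hB
  have hvA : v ∉ A := by
    intro hvA
    obtain ⟨w⟩ := (Finset.mem_filter.1 hvA).2
    cases hw : w.reverse with
    | nil => exact hbv rfl
    | cons hadj _ => exact hadj.2.2.1 rfl
  refine Or.inr ⟨v, A, B, hvA, by simp [hB], ⟨b, Finset.mem_filter.2 ⟨hb, SimpleGraph.Reachable.refl _⟩⟩,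
    ⟨a, Finset.mem_filter.2 ⟨Finset.mem_erase.2 ⟨hav, ha⟩, hr⟩⟩, ?_, ?_, ?_⟩
  · rw [Finset.disjoint_left]
    intro x hxA hxB
    exact (Finset.mem_filter.1 hxB).2 (Finset.mem_filter.1 hxA).2
  · ext x
    simp only [Finset.mem_insert, Finset.mem_union, hA, hB, Finset.mem_filter, Finset.mem_erase]
    constructor
    · rintro (rfl | ⟨hx, -⟩ | ⟨⟨-, hx⟩, -⟩) <;> assumption
    · intro hx
      by_cases hxv : x = v
      · exact Or.inl hxv
      by_cases hrx : (delGraph P v).Reachable b x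
      · exact Or.inr (Or.inl ⟨hx, hrx⟩)
      · exact Or.inr (Or.inr ⟨⟨hxv, hx⟩, hrx⟩)
  · intro x hxA y hyB hxy
    obtain ⟨hxP, hrx⟩ := Finset.mem_filter.1 hxA
    obtain ⟨hy, hry⟩ := Finset.mem_filter.1 hyB
    obtain ⟨hyv, hyP⟩ := Finset.mem_erase.1 hy
    have hxv : x ≠ v := fun h => hvA (h ▸ hxA)
    exact hry (hrx.trans (SimpleGraph.Adj.reachable ⟨hxP, hyP, hxv, hyv, hxy⟩))

/-! ## §3 A cycle of the contact graph through a traced corner -/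

/-- **A cycle through a corner.** In a non-splitting hard configuration (all degrees `≥ 2`), for a
centre `v` and a neighbour `a` with successor `b = succ a v`, there is a cycle of the contact
graph through the corner `(a, v, b)`: a simple closed polygon `Z` drawn inside the drawing of `P`,
passing through `v`, whose only edges within distance `1/2` of `v` are the bonds `[v, a]` and
`[v, b]`, both of which it contains. (Close up a `v`-avoiding bond path from `b` to `a`.)
[cite: Harborth1974, p. 14] -/
theorem exists_cycle_through_corner (hP : IsHard P) (hns : ¬ Splits P)
    (h2 : ∀ p ∈ P, 2 ≤ (nbrs P p).card) {v a : ℂ} (hv : v ∈ P) (ha : a ∈ nbrs P v) :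
    ∃ (Z : ℤ → ℂ) (n : ℕ), IsSimplePolygon Z n ∧ range (polygonLoop Z n) ⊆ drawing P ∧
      v ∈ range (polygonLoop Z n) ∧
      (∀ x ∈ range (polygonLoop Z n), ‖x - v‖ < 1 / 2 →
        x ∈ segment ℝ v a ∨ x ∈ segment ℝ v (succ P a v)) ∧
      segment ℝ v a ⊆ range (polygonLoop Z n) ∧ segment ℝ v (succ P a v) ⊆ range (polygonLoop Z n) := by
  classical
  set b := succ P a v with hbdef
  have haP : a ∈ P := (mem_nbrs.1 ha).1
  have hav : a ≠ v := ne_of_mem_nbrs ha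
  have hb : b ∈ nbrs P v := succ_mem_nbrs ha
  have hbP : b ∈ P := (mem_nbrs.1 hb).1
  have hbv : b ≠ v := ne_of_mem_nbrs hb
  have hba : b ≠ a := succ_ne (h2 v hv)
  -- a `v`-avoiding path of bonds from `b` to `a`
  obtain ⟨pth, hpth⟩ := (reachable_of_not_splits hns hv haP hbP hav hbv).exists_isPath
  set ℓ := pth.length with hℓ
  have hℓ1 : 1 ≤ ℓ := by
    rcases Nat.eq_zero_or_pos ℓ with h0 | h0
    · exact absurd (SimpleGraph.Walk.eq_of_length_eq_zero h0) hba
    · exact h0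
  -- the vertices of the path are centres other than `v`
  have hvert : ∀ m, pth.getVert m ∈ P ∧ pth.getVert m ≠ v := by
    intro m
    by_cases hm : m < ℓ
    · have h := pth.adj_getVert_succ hm
      exact ⟨h.1, h.2.2.1⟩
    · rw [pth.getVert_of_length_le (not_lt.1 hm)]; exact ⟨haP, hav⟩
  -- the cycle `v, getVert 0 = b, …, getVert ℓ = a`
  set c : ℕ → ℂ := fun k => if k = 0 then v else pth.getVert (k - 1) with hcdef
  have hc0 : c 0 = v := by simp [hcdef]
  have hcS : ∀ k, c (k + 1) = pth.getVert k := fun k => by simp [hcdef]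
  have hc1 : c 1 = b := by rw [hcS, SimpleGraph.Walk.getVert_zero]
  have hcl : c (ℓ + 1) = a := by rw [hcS, hℓ, SimpleGraph.Walk.getVert_length]
  have hcP : ∀ k, c k ∈ P := by
    intro k; rcases k with _ | k
    · rw [hc0]; exact hv
    · rw [hcS]; exact (hvert k).1
  -- consecutive vertices touch (indices `0 … ℓ`), and the closing bond
  have hcbond : ∀ k, k ≤ ℓ → ‖c (k + 1) - c k‖ = 1 := by
    intro k hk
    rcases k with _ | k
    · rw [hc1, hc0]; exact norm_sub_eq_one_of_mem_nbrs hb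
    · rw [hcS, hcS]; exact (pth.adj_getVert_succ (by omega)).2.2.2.2
  have hclose : ‖c 0 - c (ℓ + 1)‖ = 1 := by
    rw [hc0, hcl, norm_sub_rev]; exact norm_sub_eq_one_of_mem_nbrs ha
  -- injectivity on `0 … ℓ + 1`
  have hcinj : ∀ k k', k ≤ ℓ + 1 → k' ≤ ℓ + 1 → c k = c k' → k = k' := by
    intro k k' hk hk' h
    rcases k with _ | k <;> rcases k' with _ | k'
    · rfl
    · rw [hc0, hcS] at h; exact absurd h.symm (hvert k').2
    · rw [hc0, hcS] at h; exact absurd h (hvert k).2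
    · rw [hcS, hcS] at h
      have := hpth.getVert_injOn (by simp only [Set.mem_setOf_eq]; omega)
        (by simp only [Set.mem_setOf_eq]; omega) h
      rw [this]
  -- the polygon
  set n := ℓ + 2 with hndef
  have hn : 0 < n := by omega
  have hn3 : 3 ≤ n := by omega
  set Z := cycExt c n with hZdef
  have hZnat : ∀ k : ℕ, Z k = c (k % n) := fun k => cycExt_natCast c hn k
  have hZsucc : ∀ m : ℤ, Z (m + 1) = c (((m % (n : ℤ)).toNat + 1) % n) := fun m => by
    have := cycExt_add_nat c hn m 1; rwa [Nat.cast_one] at this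
  have hZm : ∀ m : ℤ, Z m = c (m % (n : ℤ)).toNat := fun m => rfl
  have hr : ∀ m : ℤ, (m % (n : ℤ)).toNat < n := fun m => by
    have h0 : 0 ≤ m % (n : ℤ) := Int.emod_nonneg _ (by omega)
    have h1 : m % (n : ℤ) < n := Int.emod_lt_of_pos _ (by omega)
    omega
  have hmem : ∀ m : ℤ, Z m ∈ P := fun m => hcP _
  -- the bond from `Z m` to `Z (m + 1)`, by cases on the reduced index
  have hedge : ∀ m : ℤ, (∃ k, k ≤ ℓ ∧ Z m = c k ∧ Z (m + 1) = c (k + 1)) ∨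
      (Z m = c (ℓ + 1) ∧ Z (m + 1) = c 0) := by
    intro m
    rw [hZm m, hZsucc m]
    set r := (m % (n : ℤ)).toNat
    have hrn := hr m
    by_cases hlt : r + 1 < n
    · left; exact ⟨r, by omega, rfl, by rw [Nat.mod_eq_of_lt hlt]⟩
    · right
      have hr' : r = ℓ + 1 := by omega
      rw [hr', show ℓ + 1 + 1 = n by omega, Nat.mod_self]; exact ⟨rfl, rfl⟩
  have hbond : ∀ m : ℤ, ‖Z (m + 1) - Z m‖ = 1 := by
    intro m
    rcases hedge m with ⟨k, hk, e0, e1⟩ | ⟨e0, e1⟩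
    · rw [e0, e1]; exact hcbond k hk
    · rw [e0, e1]; exact hclose
  have hinj : ∀ i j : ℤ, 0 ≤ i → i < n → 0 ≤ j → j < n → Z i = Z j → i = j := by
    intro i j hi0 hin hj0 hjn h
    have ei : i = ((i.toNat : ℕ) : ℤ) := (Int.toNat_of_nonneg hi0).symm
    have ej : j = ((j.toNat : ℕ) : ℤ) := (Int.toNat_of_nonneg hj0).symm
    rw [ei, ej, hZnat, hZnat, Nat.mod_eq_of_lt (by omega), Nat.mod_eq_of_lt (by omega)] at h
    have := hcinj _ _ (by omega) (by omega) h
    omega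
  have hZ : IsSimplePolygon Z n := isSimplePolygon_of_cycle hP hn3 (cycExt_periodic c n) hmem hbond hinj
  -- the range of the loop
  have hrange := range_polygonLoop Z hn
  have hdart : ∀ m : ℤ, (Z m, Z (m + 1)) ∈ darts P := fun m => mem_darts.2 ⟨⟨hmem m, hmem _⟩, hbond m⟩
  have hZ0 : Z 0 = v := by rw [show (0 : ℤ) = ((0 : ℕ) : ℤ) by simp, hZnat, Nat.zero_mod, hc0]
  have hZ1 : Z 1 = b := by rw [show (1 : ℤ) = ((1 : ℕ) : ℤ) by simp, hZnat, Nat.mod_eq_of_lt (by omega), hc1]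
  have hZl : Z (ℓ + 1 : ℕ) = a := by rw [hZnat, Nat.mod_eq_of_lt (by omega), hcl]
  have hZl1 : Z ((ℓ + 1 : ℕ) + 1) = v := by
    rw [show ((ℓ + 1 : ℕ) : ℤ) + 1 = ((ℓ + 2 : ℕ) : ℤ) by push_cast; ring, hZnat,
      show ℓ + 2 = n by omega, Nat.mod_self, hc0]
  refine ⟨Z, n, hZ, ?_, ?_, ?_, ?_, ?_⟩
  · rw [hrange]
    exact Set.iUnion_subset fun m => segment_subset_drawing (hdart m)
  · rw [hrange]; exact Set.mem_iUnion.2 ⟨0, by rw [hZ0]; exact left_mem_segment _ _ _⟩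
  · intro x hx hxv
    rw [hrange] at hx
    obtain ⟨m, hxm⟩ := Set.mem_iUnion.1 hx
    rcases hedge m with ⟨k, hk, e0, e1⟩ | ⟨e0, e1⟩
    · rw [e0, e1] at hxm
      rcases k with _ | k
      · right; rwa [hc0, hc1] at hxm
      · -- a bond of the path away from `v`: too far
        exfalso
        have h1 := half_lt_norm_sub_of_mem_segment hP (hcP (k + 1)) (hcP (k + 2)) hv
          (by rw [hcS]; exact (hvert k).2.symm) (by rw [hcS]; exact (hvert (k + 1)).2.symm)
          (hcbond (k + 1) hk) hxm
        linarith
    · left; rw [e0, e1, hcl, hc0, segment_symm] at hxm; exact hxm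
  · rw [hrange, segment_symm]
    refine Set.subset_iUnion_of_subset ((ℓ + 1 : ℕ) : ℤ) ?_
    rw [hZl, hZl1]
  · rw [hrange]
    refine Set.subset_iUnion_of_subset 0 ?_
    rw [zero_add, hZ0, hZ1]

/-! ## §4 The boundary walk visits each centre once -/

section Simple

variable {hne : P.Nonempty} {h2 : ∀ p ∈ P, 2 ≤ (nbrs P p).card}

/-- The darts of the trace in terms of the boundary walk. [cite: Harborth1974, p. 14] -/
theorem traceDart_eq_bdry (m : ℕ) :
    traceDart P hne h2 m = (bdry P hne h2 m, bdry P hne h2 ((m : ℤ) + 1)) := by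
  rw [bdry_add_one, bdry_natCast]
  have : ((m : ℤ) % (period P hne h2 : ℤ)).toNat = m % period P hne h2 := by
    rw [← Int.natCast_mod, Int.toNat_natCast]
  rw [this, traceDart_mod]

/-- The corner at `bdry m` after `bdry (m - 1)` is a corner of the trace. [cite: Harborth1974, p. 14] -/
theorem cornerSector_bdry_eq_traceCorner (m : ℕ) :
    cornerSector P (bdry P hne h2 ((m : ℤ) - 1)) (bdry P hne h2 m) =
      traceCorner P hne h2 (m + period P hne h2 - 1) := by
  have hT := period_pos (hne := hne) (h2 := h2)
  rw [traceCorner, traceDart_eq_bdry]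
  have e1 : bdry P hne h2 ((m + period P hne h2 - 1 : ℕ) : ℤ) = bdry P hne h2 ((m : ℤ) - 1) := by
    rw [← bdry_periodic ((m : ℤ) - 1), Nat.cast_sub (by omega), Nat.cast_add, Nat.cast_one]
    ring_nf
  have e2 : bdry P hne h2 (((m + period P hne h2 - 1 : ℕ) : ℤ) + 1) = bdry P hne h2 m := by
    rw [← bdry_periodic (m : ℤ), Nat.cast_sub (by omega), Nat.cast_add, Nat.cast_one]
    ring_nf
  rw [e1, e2]

/-- **Another corner at the same vertex lies in the opposite sector**: for distinct neighbours
`a₁, a₂` of `v`, the corner after `a₂` lies in the open sector from `succ a₁ v` round to `a₁`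
(angles in `(gapAngle a₁ v, 2π)` from `a₁`). [cite: Harborth1974, p. 14] -/
theorem cornerSector_subset_sector {v a₁ a₂ : ℂ} (ha₁ : a₁ ∈ nbrs P v) (ha₂ : a₂ ∈ nbrs P v)
    (hne : a₁ ≠ a₂) :
    cornerSector P a₂ v ⊆ sector v (a₁ - v) (gapAngle P a₁ v) (2 * π) (1 / 2) := by
  rintro x ⟨h0, hr, hθ0, hθ1⟩
  set τ := ccwAngle (a₁ - v) (a₂ - v) with hτ
  have hτ1 : gapAngle P a₁ v ≤ τ := gapAngle_le_ccwAngle ha₂ hne.symm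
  have hτ0 : τ ≠ 0 := fun h => hne (eq_of_ccwAngle_eq_zero ha₁ ha₂ h)
  have hrev := ccwAngle_rev hτ0
  have hτ2 : τ + gapAngle P a₂ v ≤ 2 * π := by
    have := gapAngle_le_ccwAngle (P := P) (p := v) (q := a₂) ha₁ hne
    linarith
  refine ⟨h0, hr, ?_, ccwAngle_lt_two_pi _ _⟩
  rcases ccwAngle_add_ccwAngle (a₁ - v) (a₂ - v) (x - v) with h | h
  · rw [← h]; linarith
  · have := ccwAngle_nonneg (a₁ - v) (x - v)
    linarith

/-- **The boundary walk visits each centre at most once per period** (non-splitting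
configurations). [cite: Harborth1974, p. 14] -/
theorem bdry_injOn (hP : IsHard P) (hns : ¬ Splits P) {i j : ℕ} (hi : i < period P hne h2)
    (hj : j < period P hne h2) (h : bdry P hne h2 i = bdry P hne h2 j) : i = j := by
  by_contra hij
  set T := period P hne h2 with hTdef
  set v := bdry P hne h2 i with hvdef
  -- the two darts out of `v` and their predecessors
  have hd : traceDart P hne h2 i ≠ traceDart P hne h2 j := fun e => hij (traceDart_injOn hi hj e)
  rw [traceDart_eq_bdry, traceDart_eq_bdry, ← hvdef, ← h] at hd
  have hb : bdry P hne h2 ((i : ℤ) + 1) ≠ bdry P hne h2 ((j : ℤ) + 1) := fun e => hd (by rw [e])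
  set a₁ := bdry P hne h2 ((i : ℤ) - 1) with ha₁
  set a₂ := bdry P hne h2 ((j : ℤ) - 1) with ha₂
  have hs₁ : bdry P hne h2 ((i : ℤ) + 1) = succ P a₁ v := by
    have := bdry_add_two (hne := hne) (h2 := h2) ((i : ℤ) - 1)
    rwa [show (i : ℤ) - 1 + 2 = i + 1 by ring, sub_add_cancel] at this
  have hs₂ : bdry P hne h2 ((j : ℤ) + 1) = succ P a₂ v := by
    have := bdry_add_two (hne := hne) (h2 := h2) ((j : ℤ) - 1)
    rwa [show (j : ℤ) - 1 + 2 = j + 1 by ring, sub_add_cancel, ← h] at this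
  have hane : a₁ ≠ a₂ := fun e => hb (by rw [hs₁, hs₂, e])
  have hv : v ∈ P := bdry_mem _
  have ha₁v : a₁ ∈ nbrs P v := by
    have := bdry_mem_darts (hne := hne) (h2 := h2) ((i : ℤ) - 1)
    rw [sub_add_cancel] at this
    exact mem_nbrs_of_mk_mem_darts' this
  have ha₂v : a₂ ∈ nbrs P v := by
    have := bdry_mem_darts (hne := hne) (h2 := h2) ((j : ℤ) - 1)
    rw [sub_add_cancel, ← h] at this
    exact mem_nbrs_of_mk_mem_darts' this
  -- the two corners lie in one connected piece `U` of the complement of the drawing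
  obtain ⟨U, hU, hUd, hUc⟩ := exists_preconnected_corners (hne := hne) (h2 := h2) hP
  have hK₁U : cornerSector P a₁ v ⊆ U := by
    rw [ha₁, hvdef, cornerSector_bdry_eq_traceCorner]; exact hUc _
  have hK₂U : cornerSector P a₂ v ⊆ U := by
    rw [ha₂, h, cornerSector_bdry_eq_traceCorner]; exact hUc _
  obtain ⟨x₁, hx₁⟩ := cornerSector_nonempty hP ha₁v (h2 v hv)
  obtain ⟨x₂, hx₂⟩ := cornerSector_nonempty hP ha₂v (h2 v hv)
  -- the cycle through the corner `(a₁, v, succ a₁ v)`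
  obtain ⟨Z, n, hZ, hZd, hvZ, hnear, hsa, hsb⟩ := exists_cycle_through_corner hP hns h2 hv ha₁v
  have hJ := hZ.isJordanLoop
  set γ₁ := gapAngle P a₁ v with hγ₁
  have hγ₁0 : 0 < γ₁ := by have := (gapAngle_mem hP ha₁v (h2 v hv)).1; linarith [Real.pi_pos]
  have hu : ‖a₁ - v‖ = 1 := norm_sub_eq_one_of_mem_nbrs ha₁v
  -- the opposite sector at `v`
  set S₂ := sector v (a₁ - v) γ₁ (2 * π) (1 / 2) with hS₂
  have hK₂S₂ : cornerSector P a₂ v ⊆ S₂ := cornerSector_subset_sector ha₁v ha₂v hane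
  -- points near `v` on the curve are on `[v, a₁]` or `[v, b₁]`, hence at angle `0` or `γ₁`
  have hangle : ∀ x ∈ range (polygonLoop Z n), ‖x - v‖ < 1 / 2 → x ≠ v →
      ccwAngle (a₁ - v) (x - v) = 0 ∨ ccwAngle (a₁ - v) (x - v) = γ₁ := by
    intro x hx hxv hxv'
    rcases hnear x hx hxv with hm | hm
    · left; rw [ccwAngle_eq_of_mem_segment hm hxv', ccwAngle_self]
    · right; rw [ccwAngle_eq_of_mem_segment hm hxv', hγ₁]; rfl
  -- two-sidedness of the Jordan curve at `v`
  have hsides := hJ.subset_inside_or_of_nhds hvZ (Metric.ball_mem_nhds v (by norm_num : (0 : ℝ) < 1 / 2))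
    (P := cornerSector P a₁ v) (P' := S₂) ?_ (isPreconnected_cornerSector ha₁v)
    (isPreconnected_sector hu hγ₁0.le le_rfl) ?_ ?_
  rotate_left
  · -- the ball minus the curve lies in the two sectors
    intro x ⟨hxb, hxZ⟩
    rw [Metric.mem_ball, dist_eq_norm] at hxb
    have hxv : x ≠ v := fun e => hxZ (e ▸ hvZ)
    have h0 : 0 < ‖x - v‖ := norm_pos_iff.2 (sub_ne_zero.2 hxv)
    set θ := ccwAngle (a₁ - v) (x - v) with hθ
    rcases lt_trichotomy θ γ₁ with hlt | heq | hgt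
    · rcases (ccwAngle_nonneg (a₁ - v) (x - v)).eq_or_lt with h00 | hpos
      · -- angle `0`: on the bond `[v, a₁]`
        exfalso; apply hxZ; apply hsa
        have := mem_segment_of_ccwAngle_eq (p := v) hu hu hxv (by linarith) (by rw [← h00, ccwAngle_self])
        rwa [add_sub_cancel] at this
      · exact Or.inl ⟨h0, hxb, hpos, hlt⟩
    · -- angle `γ₁`: on the bond `[v, b₁]`
      exfalso; apply hxZ; apply hsb
      have hw : ‖succ P a₁ v - v‖ = 1 := norm_sub_eq_one_of_mem_nbrs (succ_mem_nbrs ha₁v)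
      have := mem_segment_of_ccwAngle_eq (p := v) hu hw hxv (by linarith) (by rw [← hθ, heq, hγ₁]; rfl)
      rwa [add_sub_cancel] at this
    · exact Or.inr ⟨h0, hxb, hgt, ccwAngle_lt_two_pi _ _⟩
  · exact Set.subset_compl_iff_disjoint_right.2 ((disjoint_cornerSector_drawing hP hv).mono_right hZd)
  · intro x hx hxZ
    obtain ⟨h0, hxb, hgt, -⟩ := hx
    have hxv : x ≠ v := fun e => by rw [e, sub_self, norm_zero] at h0; exact lt_irrefl _ h0
    rcases hangle x hxZ hxb hxv with e | e <;> linarith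
  -- `U` misses the curve, so it is inside or outside; but it meets both sectors
  have hUZ : U ⊆ (range (polygonLoop Z n))ᶜ := Set.subset_compl_iff_disjoint_right.2 (hUd.mono_right hZd)
  have hdisj := IsJordanLoop.disjoint_inside_outside (γ := polygonLoop Z n)
  rcases hJ.subset_inside_or_subset_outside hU hUZ with hUin | hUout
  · rcases hsides with ⟨-, hS⟩ | ⟨hK, -⟩
    · exact Set.disjoint_left.1 hdisj (hUin (hK₂U hx₂)) (hS (hK₂S₂ hx₂))
    · exact Set.disjoint_left.1 hdisj (hUin (hK₁U hx₁)) (hK hx₁)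
  · rcases hsides with ⟨hK, -⟩ | ⟨-, hS⟩
    · exact Set.disjoint_left.1 hdisj (hK hx₁) (hUout (hK₁U hx₁))
    · exact Set.disjoint_left.1 hdisj (hS (hK₂S₂ hx₂)) (hUout (hK₂U hx₂))

end Simple

end Harborth

end Literature.Geometry.DiscreteGeometry

end
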